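import Mathlib
import Literature.MathematicalPhysics.QuantumFieldTheory.Balaban1983to89.B14Eq126CondGaussian

/-!
# `Balaban1983to89.B14Eq325Split` — [Balaban1988Convergent] (3.23)/(3.25) p. 270: the one-step operation
`T^{(k+1)}` absorbs the outer fluctuation integration; the last fluctuation integral of (3.25)

HONEST FRAMING (cell `lit-balaban`, verbatim): statement-level skeleton of published theorems with citation tags;
proofs where landed; nothing here is a claim about the Yang–Mills mass gap.

CITATION HEADER.  T. Bałaban, *Convergent renormalization expansions for lattice gauge theories*, Commun. Math.
Phys. **119** (1988) 243–285, doi:10.1007/bf01217741 [Balaban1988Convergent] (cell paper B14 = "[III]"; held text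
`paper:balaban1988-cmp119-convergent-renormalization`, journal page = PDF page + 242; (3.23)–(3.25) READ AS AN IMAGE
from the page render `b2b-balaban-ref1/pages/1988-cmp119-convergent-renormalization/…-p028-x2.png`, p. 270).  Unit
`lit-balaban-r11` (reader/typer of B14), SKELETON row `B14.Eq3.23–3.25` (the abstract one-step operations are
`Step.TkOps.ofOneStep`, `TkOps.tail`; THIS file: the Gaussian algebra of (3.23)/(3.25) over the finite-dimensional
block model of the k = 0 instance (1.26), `B14.Eq126CondGaussian`, reused BY NAME: `Z0`, `gaussExpect`,
`gaussExpect_exp_neg_source`).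

WHAT IS PRINTED (p. 270 [PDF 28], verbatim up to typography).  *«For each term of the obtained sum we consider the
conditional integral with respect to A_k restricted to Λ_{k+1}. The remaining integration with respect to A_k
restricted to Ω_{k+1}∩Λᶜ_{k+1} is included into the operation T^{(k+1)}. Thus we define
    T^{(k+1)} = Σ_{S_{k+1}} ∫dV_k↾_{Ωᶜ_{k+1}} δ(V̄_kV⁻¹_{k+1})ζ(Ωᶜ_{k+1}) z^{(k)} ∫dA_k↾_{Ω_{k+1}∩Λᶜ_{k+1}} χ(Ω_{k+1}∩Λᶜ_{k+1}, S_{k+1})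
      · exp[−½⟨A_k, C*Δ^{(k)}CA_k⟩ + ½⟨A_k, C*Δ^{(k)}CC^{(k)}(Λ_{k+1})C*Δ^{(k)}CA_k⟩].   (3.23)
[…] T_{k+1} = T^{(k+1)}T_k, (3.24) we get
    (Tρ_k)(V_{k+1}) = Σ_{{Ω_j},{V_j}} χ_{k+1}(Ω_{k+1})T_{k+1} exp[A_k(1/g_k², U_{k+1}) + E₀^{(k)}]
      · z^{(k)}∫dA↾_{Λ_{k+1}}χ^{(k)}(Λ_{k+1}) exp[−½⟨A, C*Δ^{(k)}CA⟩ − ⟨A, C*Δ^{(k)}CA_k⟩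
        − ½⟨A_k, C*Δ^{(k)}CC^{(k)}(Λ_{k+1})C*Δ^{(k)}CA_k⟩ + 𝐏^{(k)}(g_k,(A_k,A)) + {…} + V^{(k)}(S_{k+1},(A_k,A))].   (3.25)
Here A_k denotes the fluctuation field on Ω_{k+1}∩Λᶜ_{k+1}, and A denotes this field on Λ_{k+1}.»*

THE ALGEBRA, AND HOW IT IS FORMALIZED.  Block model as in (1.26) (`B14.Eq126CondGaussian`): inner variables
`x = A` (on Λ_{k+1}, index type `ι`, Lebesgue measure), outer variables `y = A_k` (on Ω_{k+1}∩Λᶜ_{k+1}, index type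
`κ`); the quadratic form of the full fluctuation action `⟨(A, A_k), C*Δ^{(k)}C(A, A_k)⟩` in block form
`xᵀMx + 2yᵀKx + yᵀNy` (`blockQF`; `M` = the ΛΛ-block, positive definite, `C^{(k)}(Λ_{k+1}) = M⁻¹`; `K` the cross
block; `N` the outer block).  Adding and subtracting the completed square `½yᵀKM⁻¹Kᵀy =
½⟨A_k, C*Δ^{(k)}CC^{(k)}(Λ_{k+1})C*Δ^{(k)}CA_k⟩` splits `exp[−½ blockQF]` EXACTLY into the outer weight of (3.23),
`exp[−½yᵀNy + ½yᵀKM⁻¹Kᵀy]` (`outer323`), times the inner integrand of (3.25), `exp[−½xᵀMx − yᵀKx − ½yᵀKM⁻¹Kᵀy]`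
(`inner325`): `exp_neg_half_blockQF_eq`.  THE POINT of the subtraction (why «the remaining integration … is included
into the operation T^{(k+1)}» is legitimate): the free inner integral is INDEPENDENT of the outer variables,
`∫dx exp[inner325(x, y)] = Z^{(0)} = ∫dx e^{−½xᵀMx}` for every `y` (`integral_exp_inner325`, from
`B14.Eq126CondGaussian.gaussExpect_exp_neg_source`), so all A_k-dependence of the last factor of (3.25) sits in
χ^{(k)}, 𝐏^{(k)}, {…}, V^{(k)}; and the outer weight IS the x-marginal of the joint Gaussian:
`∫dx exp[−½ blockQF(x, y)] = Z^{(0)}·exp[outer323(y)]` (`integral_exp_neg_half_blockQF`).  (3.24) is composition of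
operations (`T324`, `T324_apply`).

WHAT IS PROVED (kernel-checked, no `sorry`, standard axioms): everything below.  Definitions: `blockQF`, `outer323`,
`inner325`, `T324`.

WHAT IS NOT PROVED HERE (and not claimed): the displays as operations on densities (the sums over S_{k+1},
{Ω_j}, {V_j}, the δ-function and ζ, z^{(k)}, χ, 𝐏^{(k)}, V^{(k)} — carriers `Step.TkOps`, `B14.Eq315Repr`); the
identification of the blocks with print's operators C, Δ^{(k)}, C^{(k)}(Λ_{k+1}) (B10/B12).  NOT summit progress:
the Gaussian bookkeeping of two printed displays.
-/

noncomputable section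

open _root_.MeasureTheory Matrix Real
open scoped Matrix

namespace Literature.MathematicalPhysics.QuantumFieldTheory.Balaban1983to89.B14.Eq325Split

open Literature.MathematicalPhysics.QuantumFieldTheory.Balaban1983to89.B14.Eq126CondGaussian
  (Z0 gaussExpect Z0_pos gaussExpect_exp_neg_source)

variable {ι : Type*} [Fintype ι] [DecidableEq ι] {κ : Type*} [Fintype κ]

/-! ## §1. The block quadratic form and its split into (3.23) × (3.25) -/

/-- `⟨(A, A_k), C*Δ^{(k)}C(A, A_k)⟩` in block form: `xᵀMx + 2yᵀKx + yᵀNy`, `x = A` (inner, on Λ_{k+1}), `y = A_k`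
(outer, on Ω_{k+1}∩Λᶜ_{k+1}). [cite: Balaban1988Convergent, (3.23)-(3.25) p.270] -/
def blockQF (M : Matrix ι ι ℝ) (K : Matrix κ ι ℝ) (N : Matrix κ κ ℝ) (x : ι → ℝ) (y : κ → ℝ) : ℝ :=
  x ⬝ᵥ M *ᵥ x + 2 * (y ⬝ᵥ K *ᵥ x) + y ⬝ᵥ N *ᵥ y

/-- **The exponent of (3.23)** (outer variables only):
`−½⟨A_k, C*Δ^{(k)}CA_k⟩ + ½⟨A_k, C*Δ^{(k)}CC^{(k)}(Λ_{k+1})C*Δ^{(k)}CA_k⟩ = −½yᵀNy + ½yᵀKM⁻¹Kᵀy`.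
[cite: Balaban1988Convergent, (3.23) p.270] -/
def outer323 (M : Matrix ι ι ℝ) (K : Matrix κ ι ℝ) (N : Matrix κ κ ℝ) (y : κ → ℝ) : ℝ :=
  -(1/2 : ℝ) * (y ⬝ᵥ N *ᵥ y) + (1/2 : ℝ) * (y ⬝ᵥ (K * M⁻¹ * Kᵀ) *ᵥ y)

/-- **The free exponent of the last integral of (3.25)**:
`−½⟨A, C*Δ^{(k)}CA⟩ − ⟨A, C*Δ^{(k)}CA_k⟩ − ½⟨A_k, C*Δ^{(k)}CC^{(k)}(Λ_{k+1})C*Δ^{(k)}CA_k⟩ = −½xᵀMx − yᵀKx − ½yᵀKM⁻¹Kᵀy`.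
[cite: Balaban1988Convergent, (3.25) p.270] -/
def inner325 (M : Matrix ι ι ℝ) (K : Matrix κ ι ℝ) (x : ι → ℝ) (y : κ → ℝ) : ℝ :=
  -(1/2 : ℝ) * (x ⬝ᵥ M *ᵥ x) - y ⬝ᵥ K *ᵥ x - (1/2 : ℝ) * (y ⬝ᵥ (K * M⁻¹ * Kᵀ) *ᵥ y)

/-- **Add and subtract the completed square**: `−½ blockQF(x, y) = outer323(y) + inner325(x, y)`.
[cite: Balaban1988Convergent, (3.23)-(3.25) p.270] -/
theorem neg_half_blockQF_eq (M : Matrix ι ι ℝ) (K : Matrix κ ι ℝ) (N : Matrix κ κ ℝ) (x : ι → ℝ) (y : κ → ℝ) :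
    -(1/2 : ℝ) * blockQF M K N x y = outer323 M K N y + inner325 M K x y := by
  unfold blockQF outer323 inner325
  ring

/-- The same on the exponentials: `exp[−½⟨(A,A_k), C*Δ^{(k)}C(A,A_k)⟩] = exp[(3.23)-exponent] · exp[(3.25)-free exponent]`.
[cite: Balaban1988Convergent, (3.23)-(3.25) p.270] -/
theorem exp_neg_half_blockQF_eq (M : Matrix ι ι ℝ) (K : Matrix κ ι ℝ) (N : Matrix κ κ ℝ) (x : ι → ℝ)
    (y : κ → ℝ) :
    Real.exp (-(1/2 : ℝ) * blockQF M K N x y)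
      = Real.exp (outer323 M K N y) * Real.exp (inner325 M K x y) := by
  rw [neg_half_blockQF_eq, Real.exp_add]

/-! ## §2. The free inner integral of (3.25) does not depend on the outer variables -/

/-- **«The remaining integration with respect to A_k … is included into the operation T^{(k+1)}» — why this is
consistent**: the free last integral of (3.25) is independent of A_k,
`∫ dA↾_{Λ_{k+1}} exp[−½⟨A,·A⟩ − ⟨A,·A_k⟩ − ½⟨A_k, ·C^{(k)}(Λ_{k+1})·A_k⟩] = Z^{(0)} = ∫ dA↾_{Λ_{k+1}} e^{−½⟨A,·A⟩}`
for every A_k (the completed square is exactly the Gaussian contribution of the cross term;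
`B14.Eq126CondGaussian.gaussExpect_exp_neg_source`). [cite: Balaban1988Convergent, (3.25) p.270] -/
theorem integral_exp_inner325 {M : Matrix ι ι ℝ} (hM : M.PosDef) (K : Matrix κ ι ℝ) (y : κ → ℝ) :
    ∫ x : ι → ℝ, Real.exp (inner325 M K x y) = Z0 M := by
  have hZ : Z0 M ≠ 0 := (Z0_pos hM).ne'
  have h := gaussExpect_exp_neg_source hM K y
  unfold gaussExpect at h
  rw [inv_mul_eq_iff_eq_mul₀ hZ] at h
  have hpt : ∀ x : ι → ℝ, Real.exp (inner325 M K x y)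
      = Real.exp (-(y ⬝ᵥ K *ᵥ x)) * Real.exp (-(1/2 : ℝ) * (x ⬝ᵥ M *ᵥ x))
          * Real.exp (-((1/2 : ℝ) * (y ⬝ᵥ (K * M⁻¹ * Kᵀ) *ᵥ y))) := by
    intro x
    rw [← Real.exp_add, ← Real.exp_add]
    unfold inner325
    congr 1
    ring
  simp_rw [hpt]
  rw [integral_mul_const, h, mul_assoc, ← Real.exp_add, add_neg_cancel, Real.exp_zero, mul_one]

/-- Hence the free inner integral takes the same value for any two outer configurations.
[cite: Balaban1988Convergent, (3.25) p.270] -/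
theorem integral_exp_inner325_indep {M : Matrix ι ι ℝ} (hM : M.PosDef) (K : Matrix κ ι ℝ) (y y' : κ → ℝ) :
    ∫ x : ι → ℝ, Real.exp (inner325 M K x y) = ∫ x : ι → ℝ, Real.exp (inner325 M K x y') := by
  rw [integral_exp_inner325 hM, integral_exp_inner325 hM]

/-- **The outer weight of (3.23) is the marginal**: integrating the joint Gaussian weight over the inner variables,
`∫ dA↾_{Λ_{k+1}} exp[−½⟨(A, A_k), C*Δ^{(k)}C(A, A_k)⟩] = Z^{(0)}·exp[−½⟨A_k,·A_k⟩ + ½⟨A_k, ·C^{(k)}(Λ_{k+1})·A_k⟩]`.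
[cite: Balaban1988Convergent, (3.23) p.270] -/
theorem integral_exp_neg_half_blockQF {M : Matrix ι ι ℝ} (hM : M.PosDef) (K : Matrix κ ι ℝ) (N : Matrix κ κ ℝ)
    (y : κ → ℝ) :
    ∫ x : ι → ℝ, Real.exp (-(1/2 : ℝ) * blockQF M K N x y) = Z0 M * Real.exp (outer323 M K N y) := by
  simp_rw [exp_neg_half_blockQF_eq]
  rw [integral_const_mul, integral_exp_inner325 hM, mul_comm]

/-! ## §3. (3.24): `T_{k+1} = T^{(k+1)} T_k` -/

/-- **(3.24)** `T_{k+1} = T^{(k+1)}T_k`: the accumulated operation is the composition of the one-step operation with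
the previous one (operations typed as maps of densities `D → D`). [cite: Balaban1988Convergent, (3.24) p.270] -/
def T324 {D : Type*} (Tstep Tk : D → D) : D → D := Tstep ∘ Tk

/-- (3.24) unfolded: `T_{k+1} ρ = T^{(k+1)}(T_k ρ)`. [cite: Balaban1988Convergent, (3.24) p.270] -/
theorem T324_apply {D : Type*} (Tstep Tk : D → D) (ρ : D) : T324 Tstep Tk ρ = Tstep (Tk ρ) := rfl

end Literature.MathematicalPhysics.QuantumFieldTheory.Balaban1983to89.B14.Eq325Split
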